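import Literature.Probability.Percolation.AnchoredIsoperimetricProfile
import Literature.Probability.Percolation.ConstrainedClusters
import HarnessLib

/-!
# Cerf–Dembin 2020, proof of Theorem 1.2, I: the exploration of `C(0)` and the cluster in a box

Topic: `Literature/Probability/Percolation`. First of the proof files of the named fact
`Literature.Probability.Percolation.CerfDembin2020_thm12` (`AnchoredIsoperimetricProfile.lean`;
R. Cerf, B. Dembin, *Vanishing of the anchored isoperimetric profile in bond percolation at `p_c`*,
Electron. Commun. Probab. 25 (2020), arXiv:1903.08065, Thm. 1.2 and its proof, §2). This file is the
deterministic (configuration-wise) combinatorics of the printed proof: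

* the exploration process of the cluster of the origin, "`𝒞_0 = {0}`,
  `𝒜_{l+1} = {x : ∃ y ∈ 𝒞_l, ⟨x,y⟩ ∈ ∂°𝒞_l}`, `𝒞_{l+1} = 𝒞_l ∪ 𝒜_{l+1}`" (§2, proof of Thm. 1.2),
  taken as a HYPOTHESIS STRUCTURE on a sequence `C : ℕ → Finset (Site d)` (`C 0 = {0}`,
  `C (l+1) = C l ∪ ⋃_{y ∈ C l} {x ∼ y : ⟨y,x⟩ open}`; the sequence itself is produced by `Nat.rec`
  where it is used): every `𝒞_l` is a valid subgraph of `C(0)` (`explore_isValidSubgraph`), lies in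
  the box `Λ(l) = [-l,l]^d` and in the cluster of `0` inside `Λ(l)` (`explore_subset_boxCluster`), and
  "`|∂°𝒞_l| ≤ 2d |𝒜_{l+1}|`" (`card_openBoundary_explore_le`, the printed inequality (iter));
* the cluster of `0` explored inside the box `[-n,n]^d` ("we resume our exploration but with the
  constraint that we do not explore anything outside the box"; its terminal state is the set of
  vertices joined to `0` by an open path inside the box, the tree's
  `openClusterIn (withinGraph (zdGraph d) Λ(n)) ω 0` of `ConstrainedClusters.lean`): it is a valid
  subgraph (`isValidSubgraph_boxCluster`) and each of its open boundary edges leaves the box through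
  one of the `2d` faces, whence `|∂° ·| ≤ Σ_faces |cluster ∩ face|`
  (`card_openBoundary_boxCluster_le`; printed: "there exists one face of `[-n,n]^d` such that there
  are at least … vertices that are connected to `0` by a `p_c`-open path that remains inside the box").

The volume-growth induction and the probabilistic half are in the sequel files
`AnchoredProfileGrowth.lean`, `AnchoredIsoperimetricProfileProofs.lean`.

## References

* R. Cerf, B. Dembin, ECP 25 (2020), paper no. 19, arXiv:1903.08065, §2, proof of Theorem 1.2.
-/

noncomputable section

namespace Literature.Probability.Percolation

open LatticeModels Finset
open scoped Classical

namespace CerfDembin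

/-! ## Open clusters are connected through themselves -/

section Cluster

variable {V : Type*}

/-- A vertex of the `K`-constrained open cluster of `x` is joined to `x` by an open path all of
whose vertices lie in that cluster (every vertex on an open `K`-path from `x` is itself in the
cluster). [folklore] -/
theorem reachable_within_openClusterIn {K : SimpleGraph V} {ω : BondConfig V} {x y : V}
    (h : y ∈ openClusterIn K ω x) :
    (openGraph ω ⊓ withinGraph ⊤ (openClusterIn K ω x)).Reachable x y := by
  rw [mem_openClusterIn_iff] at h
  obtain ⟨p⟩ := h
  suffices H : ∀ u (q : (openGraph ω ⊓ K).Walk u y), (openGraph ω ⊓ K).Reachable x u →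
      (openGraph ω ⊓ withinGraph ⊤ (openClusterIn K ω x)).Reachable u y from
    H x p SimpleGraph.Reachable.rfl
  clear p
  intro u q
  induction q with
  | nil => intro _; rfl
  | @cons u v w huv q ih =>
    intro hu
    have hv : (openGraph ω ⊓ K).Reachable x v := hu.trans huv.reachable
    rw [SimpleGraph.inf_adj] at huv
    have hstep : (openGraph ω ⊓ withinGraph ⊤ (openClusterIn K ω x)).Adj u v := by
      rw [SimpleGraph.inf_adj, withinGraph_adj, SimpleGraph.top_adj]
      exact ⟨huv.1, huv.1.ne, mem_openClusterIn_iff.2 hu, mem_openClusterIn_iff.2 hv⟩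
    exact hstep.reachable.trans (ih hv)

/-- Hence the tree's event `{x ↔ y in C}` holds with `C` the constrained cluster of `x` itself, for
every `y` in that cluster: constrained clusters are "valid" in the sense of Cerf–Dembin.
[cite: CerfDembin2020, §1 (valid subgraph of C(0))] -/
theorem openConnIn_of_mem_openClusterIn {K : SimpleGraph V} {ω : BondConfig V} {x y : V}
    (h : y ∈ openClusterIn K ω x) : ω ∈ openConnIn (openClusterIn K ω x) x y := by
  rw [openConnIn_eq_openConnVia (self_mem_openClusterIn K ω x)]
  exact mem_openClusterIn_iff.2 (reachable_within_openClusterIn h)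

end Cluster

variable {d : ℕ}

/-! ## Boxes and nearest-neighbour steps -/

/-- A nearest-neighbour step out of `Λ(l)` lands in `Λ(l+1)`. [folklore] -/
theorem mem_box_succ_of_adj {l : ℕ} {x y : Site d} (h : (zdGraph d).Adj y x) (hy : y ∈ box d l) :
    x ∈ box d (l + 1) := by
  rw [mem_box] at hy ⊢
  obtain ⟨i, hi⟩ := (zdGraph_adj_iff y x).1 h
  intro j
  obtain ⟨h1, h2⟩ := hy j
  have hs : (Pi.single i (1 : ℤ) : Site d) j = if j = i then 1 else 0 := Pi.single_apply i 1 j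
  have hx : x j = y j + (Pi.single i (1 : ℤ) : Site d) j ∨
      x j = y j - (Pi.single i (1 : ℤ) : Site d) j := by
    rcases hi with h' | h'
    · exact Or.inl (by rw [h', Pi.add_apply])
    · exact Or.inr (by rw [h', Pi.add_apply]; ring)
  push_cast
  split_ifs at hs <;> rcases hx with hx | hx <;> rw [hx, hs] <;> omega

/-- The open edge boundary count of the tree (`openEdgeBoundaryCard`, an `ncard`) as the cardinality
of a finset. [folklore] -/
theorem openEdgeBoundaryCard_eq_card_filter (ω : BondConfig (Site d)) (H : Finset (Site d)) :
    openEdgeBoundaryCard d ω H = #((edgeBoundary (zdGraph d) H).filter (· ∈ ω)) := by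
  rw [openEdgeBoundaryCard, ← Set.ncard_coe_finset]
  congr 1
  ext e
  simp only [Set.mem_inter_iff, Finset.coe_filter, Set.mem_setOf_eq, Finset.mem_coe]

/-- An open boundary edge of `H` is `s(a, b)` with `a ∈ H`, `b ∉ H`, `a ∼ b` and `s(a,b)` open.
[folklore] -/
theorem exists_of_mem_openBoundary {ω : BondConfig (Site d)} {H : Finset (Site d)} {e : Sym2 (Site d)}
    (he : e ∈ (edgeBoundary (zdGraph d) H).filter (· ∈ ω)) :
    ∃ a ∈ H, ∃ b ∉ H, (zdGraph d).Adj a b ∧ s(a, b) ∈ ω ∧ e = s(a, b) := by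
  rw [mem_filter, mem_edgeBoundary_iff] at he
  obtain ⟨⟨he, ⟨a, ha, hae⟩, ⟨b, hb, hbe⟩⟩, hω⟩ := he
  have hab : a ≠ b := fun h => hb (h ▸ ha)
  have heq : e = s(a, b) := (Sym2.mem_and_mem_iff hab).1 ⟨hae, hbe⟩
  subst heq
  exact ⟨a, ha, b, hb, he, hω, rfl⟩

/-! ## The exploration process `𝒞_l` (Cerf–Dembin 2020, §2) -/

section Explore

variable {ω : BondConfig (Site d)} {C : ℕ → Finset (Site d)}

/-- `𝒞_l ⊆ 𝒞_{l+1}`. [cite: CerfDembin2020, §2 (proof of Thm. 1.2, 𝒞_{l+1} = 𝒞_l ∪ 𝒜_{l+1})] -/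
theorem explore_subset_succ
    (hsucc : ∀ l, C (l + 1) = C l ∪ (C l).biUnion fun y =>
      ((zdGraph d).neighborFinset y).filter fun x => s(y, x) ∈ ω)
    (l : ℕ) : C l ⊆ C (l + 1) := by
  rw [hsucc l]; exact subset_union_left

/-- Membership in `𝒞_{l+1}`: either in `𝒞_l`, or a neighbour of `𝒞_l` along an open edge (the set
`𝒜_{l+1}`). [cite: CerfDembin2020, §2 (proof of Thm. 1.2, definition of 𝒜_{l+1})] -/
theorem mem_explore_succ_iff
    (hsucc : ∀ l, C (l + 1) = C l ∪ (C l).biUnion fun y =>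
      ((zdGraph d).neighborFinset y).filter fun x => s(y, x) ∈ ω)
    {l : ℕ} {x : Site d} :
    x ∈ C (l + 1) ↔ x ∈ C l ∨ ∃ y ∈ C l, (zdGraph d).Adj y x ∧ s(y, x) ∈ ω := by
  rw [hsucc l, mem_union, mem_biUnion]
  simp only [mem_filter, SimpleGraph.mem_neighborFinset]

/-- `0 ∈ 𝒞_l`. [cite: CerfDembin2020, §2 (proof of Thm. 1.2, 𝒞_0 = {0})] -/
theorem zero_mem_explore (h0 : C 0 = {0})
    (hsucc : ∀ l, C (l + 1) = C l ∪ (C l).biUnion fun y =>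
      ((zdGraph d).neighborFinset y).filter fun x => s(y, x) ∈ ω)
    (l : ℕ) : (0 : Site d) ∈ C l := by
  induction l with
  | zero => rw [h0]; exact mem_singleton_self 0
  | succ l ih => exact explore_subset_succ hsucc l ih

/-- Every vertex of `𝒞_l` is joined to `0` by an open path inside the box `Λ(l)` ("by construction
the set `𝒞_n` is inside the box `[-n,n]^d`"). [cite: CerfDembin2020, §2 (proof of Thm. 1.2)] -/
theorem explore_reachable_box (h0 : C 0 = {0})
    (hsucc : ∀ l, C (l + 1) = C l ∪ (C l).biUnion fun y =>
      ((zdGraph d).neighborFinset y).filter fun x => s(y, x) ∈ ω)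
    (l : ℕ) :
    ∀ x ∈ C l, (openGraph ω ⊓ withinGraph (zdGraph d) ↑(box d l)).Reachable 0 x := by
  induction l with
  | zero => intro x hx; rw [h0, mem_singleton] at hx; subst hx; rfl
  | succ l ih =>
    intro x hx
    have hmono : openGraph ω ⊓ withinGraph (zdGraph d) ↑(box d l) ≤
        openGraph ω ⊓ withinGraph (zdGraph d) ↑(box d (l + 1)) :=
      inf_le_inf_left _ (withinGraph_mono _ (Finset.coe_subset.2 (box_mono d (Nat.le_succ l))))
    rcases (mem_explore_succ_iff hsucc).1 hx with hx | ⟨y, hy, hadj, hopen⟩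
    · exact (ih x hx).mono hmono
    · have hybox : y ∈ box d l :=
        Finset.mem_coe.1 (openClusterIn_withinGraph_subset (G := zdGraph d)
          (Finset.mem_coe.2 (zero_mem_box d l)) ω (mem_openClusterIn_iff.2 (ih y hy)))
      have hxbox : x ∈ box d (l + 1) := mem_box_succ_of_adj hadj hybox
      refine ((ih y hy).mono hmono).trans (SimpleGraph.Adj.reachable ?_)
      rw [SimpleGraph.inf_adj, openGraph_adj, withinGraph_adj]
      exact ⟨⟨hopen, hadj.ne⟩, hadj, Finset.mem_coe.2 (box_mono d (Nat.le_succ l) hybox),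
        Finset.mem_coe.2 hxbox⟩

/-- Every vertex of `𝒞_l` is joined to `0` by an open path inside `𝒞_l` ("`𝒞_l` is a valid
subgraph of `𝒞(0)`"). [cite: CerfDembin2020, §2 (proof of Thm. 1.2)] -/
theorem explore_reachable_self (h0 : C 0 = {0})
    (hsucc : ∀ l, C (l + 1) = C l ∪ (C l).biUnion fun y =>
      ((zdGraph d).neighborFinset y).filter fun x => s(y, x) ∈ ω)
    (l : ℕ) :
    ∀ x ∈ C l, (openGraph ω ⊓ withinGraph ⊤ (↑(C l) : Set (Site d))).Reachable 0 x := by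
  induction l with
  | zero => intro x hx; rw [h0, mem_singleton] at hx; subst hx; rfl
  | succ l ih =>
    intro x hx
    have hmono : openGraph ω ⊓ withinGraph ⊤ (↑(C l) : Set (Site d)) ≤
        openGraph ω ⊓ withinGraph ⊤ (↑(C (l + 1)) : Set (Site d)) :=
      inf_le_inf_left _ (withinGraph_mono _ (Finset.coe_subset.2 (explore_subset_succ hsucc l)))
    rcases (mem_explore_succ_iff hsucc).1 hx with hx' | ⟨y, hy, hadj, hopen⟩
    · exact (ih x hx').mono hmono
    · refine ((ih y hy).mono hmono).trans (SimpleGraph.Adj.reachable ?_)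
      rw [SimpleGraph.inf_adj, openGraph_adj, withinGraph_adj, SimpleGraph.top_adj]
      exact ⟨⟨hopen, hadj.ne⟩, hadj.ne, Finset.mem_coe.2 (explore_subset_succ hsucc l hy),
        Finset.mem_coe.2 hx⟩

/-- **`𝒞_l` is a valid subgraph of `𝒞(0)`.** [cite: CerfDembin2020, §2 (proof of Thm. 1.2)] -/
theorem explore_isValidSubgraph (h0 : C 0 = {0})
    (hsucc : ∀ l, C (l + 1) = C l ∪ (C l).biUnion fun y =>
      ((zdGraph d).neighborFinset y).filter fun x => s(y, x) ∈ ω)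
    (l : ℕ) : IsValidSubgraph d ω (C l) := by
  refine ⟨zero_mem_explore h0 hsucc l, fun x hx => ?_⟩
  rw [openConnIn_eq_openConnVia (Finset.mem_coe.2 (zero_mem_explore h0 hsucc l))]
  exact mem_openClusterIn_iff.2 (explore_reachable_self h0 hsucc l x hx)

/-- **The exploration inequality** "`|∂°𝒞_l| ≤ 2d |𝒜_{l+1}|`", i.e.
`|𝒞_{l+1}| ≥ |𝒞_l| + |∂°𝒞_l| / 2d` (display (iter)): every open boundary edge of `𝒞_l` is incident
to a vertex of `𝒜_{l+1} = 𝒞_{l+1} ∖ 𝒞_l`, and every vertex of `ℤ^d` has `2d` incident edges.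
[cite: CerfDembin2020, §2 (proof of Thm. 1.2, inequality (iter))] -/
theorem card_openBoundary_explore_le
    (hsucc : ∀ l, C (l + 1) = C l ∪ (C l).biUnion fun y =>
      ((zdGraph d).neighborFinset y).filter fun x => s(y, x) ∈ ω)
    (l : ℕ) :
    #((edgeBoundary (zdGraph d) (C l)).filter (· ∈ ω)) ≤ 2 * d * (#(C (l + 1)) - #(C l)) := by
  have hsub : (edgeBoundary (zdGraph d) (C l)).filter (· ∈ ω) ⊆
      (C (l + 1) \ C l).biUnion fun b => (zdGraph d).incidenceFinset b := by
    intro e he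
    obtain ⟨a, ha, b, hb, hadj, hω, rfl⟩ := exists_of_mem_openBoundary he
    rw [mem_biUnion]
    refine ⟨b, mem_sdiff.2 ⟨(mem_explore_succ_iff hsucc).2 (Or.inr ⟨a, ha, hadj, hω⟩), hb⟩, ?_⟩
    rw [SimpleGraph.mem_incidenceFinset]
    exact ⟨hadj, Sym2.mem_mk_right a b⟩
  have hcard := card_sdiff_add_card_eq_card (explore_subset_succ hsucc l)
  calc #((edgeBoundary (zdGraph d) (C l)).filter (· ∈ ω))
      ≤ #((C (l + 1) \ C l).biUnion fun b => (zdGraph d).incidenceFinset b) := card_le_card hsub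
    _ ≤ ∑ b ∈ C (l + 1) \ C l, #((zdGraph d).incidenceFinset b) := card_biUnion_le
    _ = ∑ b ∈ C (l + 1) \ C l, 2 * d := sum_congr rfl fun b _ => by
        rw [SimpleGraph.card_incidenceFinset_eq_degree, ← SimpleGraph.card_neighborFinset_eq_degree]
        exact card_neighborFinset_zdGraph_holds b
    _ = 2 * d * (#(C (l + 1)) - #(C l)) := by
        rw [sum_const, smul_eq_mul, Nat.eq_sub_of_add_eq hcard, mul_comm]

end Explore

/-! ## The cluster of the origin inside the box `Λ(n)` -/

/-- The cluster of `0` explored inside `Λ(n)` stays inside `Λ(n)`. [folklore] -/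
theorem boxCluster_subset (n : ℕ) (ω : BondConfig (Site d)) :
    openClusterIn (withinGraph (zdGraph d) ↑(box d n)) ω 0 ⊆ ↑(box d n) :=
  openClusterIn_withinGraph_subset (Finset.mem_coe.2 (zero_mem_box d n)) ω

/-- The finset of the cluster of `0` inside `Λ(n)` coerces back to the cluster. [folklore] -/
theorem coe_filter_boxCluster (n : ℕ) (ω : BondConfig (Site d)) :
    (↑((box d n).filter fun x => x ∈ openClusterIn (withinGraph (zdGraph d) ↑(box d n)) ω 0) :
        Set (Site d)) = openClusterIn (withinGraph (zdGraph d) ↑(box d n)) ω 0 := by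
  ext x
  simp only [coe_filter, Set.mem_setOf_eq]
  exact ⟨fun h => h.2, fun h => ⟨boxCluster_subset n ω h, h⟩⟩

/-- **The cluster of `0` inside the box is a valid subgraph of `𝒞(0)`** (the terminal state `𝒞'_l`
of the exploration constrained to `[-n,n]^d`). [cite: CerfDembin2020, §2 (proof of Thm. 1.2, 𝒞'_l)] -/
theorem isValidSubgraph_boxCluster (n : ℕ) (ω : BondConfig (Site d)) :
    IsValidSubgraph d ω
      ((box d n).filter fun x => x ∈ openClusterIn (withinGraph (zdGraph d) ↑(box d n)) ω 0) := by
  refine ⟨mem_filter.2 ⟨zero_mem_box d n, self_mem_openClusterIn _ ω 0⟩, fun x hx => ?_⟩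
  rw [coe_filter_boxCluster]
  exact openConnIn_of_mem_openClusterIn (mem_filter.1 hx).2

/-- `𝒞_n` lies in the cluster of `0` inside `Λ(n)` ("`𝒞'_0 = 𝒞_n`" and the constrained exploration
only grows). [cite: CerfDembin2020, §2 (proof of Thm. 1.2, 𝒞'_0 = 𝒞_n)] -/
theorem explore_subset_boxCluster {ω : BondConfig (Site d)} {C : ℕ → Finset (Site d)}
    (h0 : C 0 = {0})
    (hsucc : ∀ l, C (l + 1) = C l ∪ (C l).biUnion fun y =>
      ((zdGraph d).neighborFinset y).filter fun x => s(y, x) ∈ ω)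
    (n : ℕ) :
    C n ⊆ (box d n).filter fun x => x ∈ openClusterIn (withinGraph (zdGraph d) ↑(box d n)) ω 0 := by
  intro x hx
  have hmem : x ∈ openClusterIn (withinGraph (zdGraph d) ↑(box d n)) ω 0 :=
    mem_openClusterIn_iff.2 (explore_reachable_box h0 hsucc n x hx)
  exact mem_filter.2 ⟨boxCluster_subset n ω hmem, hmem⟩

/-- **Open boundary edges of the cluster inside the box leave the box through a face**: an open edge
`s(a, b)` with `a` in the cluster of `0` inside `Λ(n)` and `b` outside that cluster has `b ∉ Λ(n)`
(else `b` would be explored), so `a` lies on a face `{x_i = ± n}` and `b = a ± e_i`. Consequently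
`|∂°(cluster)| ≤ Σ_{i, ±} |cluster ∩ {x_i = ± n}|`.
[cite: CerfDembin2020, §2 (proof of Thm. 1.2, "there exists one face of [-n,n]^d …")] -/
theorem card_openBoundary_boxCluster_le (n : ℕ) (ω : BondConfig (Site d)) :
    #((edgeBoundary (zdGraph d) ((box d n).filter fun x =>
        x ∈ openClusterIn (withinGraph (zdGraph d) ↑(box d n)) ω 0)).filter (· ∈ ω)) ≤
      ∑ i : Fin d,
        (#(((box d n).filter fun x =>
            x ∈ openClusterIn (withinGraph (zdGraph d) ↑(box d n)) ω 0).filter fun x => x i = (n : ℤ)) +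
         #(((box d n).filter fun x =>
            x ∈ openClusterIn (withinGraph (zdGraph d) ↑(box d n)) ω 0).filter fun x => x i = -(n : ℤ))) := by
  set Kf := (box d n).filter fun x => x ∈ openClusterIn (withinGraph (zdGraph d) ↑(box d n)) ω 0
    with hKf
  have hsub : (edgeBoundary (zdGraph d) Kf).filter (· ∈ ω) ⊆
      (univ : Finset (Fin d)).biUnion fun i =>
        (Kf.filter fun x => x i = (n : ℤ)).image (fun a => s(a, a + Pi.single i 1)) ∪
        (Kf.filter fun x => x i = -(n : ℤ)).image (fun a => s(a, a - Pi.single i 1)) := by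
    intro e he
    obtain ⟨a, ha, b, hb, hadj, hω, rfl⟩ := exists_of_mem_openBoundary he
    have ha' := mem_filter.1 ha
    have hbbox : b ∉ box d n := fun hbox => hb (mem_filter.2 ⟨hbox,
      mem_openClusterIn_of_adj ha'.2 (withinGraph_adj.2 ⟨hadj, Finset.mem_coe.2 ha'.1,
        Finset.mem_coe.2 hbox⟩) hω⟩)
    have habox := mem_box.1 ha'.1
    rw [mem_box, not_forall] at hbbox
    obtain ⟨j, hj⟩ := hbbox
    obtain ⟨i, hi⟩ := (zdGraph_adj_iff a b).1 hadj
    rw [mem_biUnion]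
    refine ⟨i, mem_univ i, ?_⟩
    rw [mem_union, mem_image, mem_image]
    have hs : ∀ j', (Pi.single i (1 : ℤ) : Site d) j' = if j' = i then 1 else 0 :=
      fun j' => Pi.single_apply i 1 j'
    rcases hi with hb' | ha''
    · left
      have hcoord : ∀ j', b j' = a j' + if j' = i then (1 : ℤ) else 0 := fun j' => by
        rw [hb', Pi.add_apply, hs]
      have hji : j = i := by
        by_contra hji
        have h1 := hcoord j
        rw [if_neg hji] at h1
        have h2 := habox j
        exact hj (by rw [h1]; omega)
      subst hji
      have h1 := hcoord j
      rw [if_pos rfl] at h1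
      have h2 := habox j
      refine ⟨a, mem_filter.2 ⟨ha, by omega⟩, by rw [hb']⟩
    · right
      have hcoord : ∀ j', b j' = a j' - if j' = i then (1 : ℤ) else 0 := fun j' => by
        rw [ha'', Pi.add_apply, hs]; ring
      have hji : j = i := by
        by_contra hji
        have h1 := hcoord j
        rw [if_neg hji] at h1
        have h2 := habox j
        exact hj (by rw [h1]; omega)
      subst hji
      have h1 := hcoord j
      rw [if_pos rfl] at h1
      have h2 := habox j
      refine ⟨a, mem_filter.2 ⟨ha, by omega⟩, ?_⟩
      rw [ha'', add_sub_cancel_right]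
  calc #((edgeBoundary (zdGraph d) Kf).filter (· ∈ ω))
      ≤ #((univ : Finset (Fin d)).biUnion fun i =>
          (Kf.filter fun x => x i = (n : ℤ)).image (fun a => s(a, a + Pi.single i 1)) ∪
          (Kf.filter fun x => x i = -(n : ℤ)).image (fun a => s(a, a - Pi.single i 1))) := card_le_card hsub
    _ ≤ ∑ i, #((Kf.filter fun x => x i = (n : ℤ)).image (fun a => s(a, a + Pi.single i 1)) ∪
          (Kf.filter fun x => x i = -(n : ℤ)).image (fun a => s(a, a - Pi.single i 1))) := card_biUnion_le
    _ ≤ ∑ i, (#(Kf.filter fun x => x i = (n : ℤ)) + #(Kf.filter fun x => x i = -(n : ℤ))) := by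
        gcongr with i
        exact (card_union_le _ _).trans (add_le_add card_image_le card_image_le)

end CerfDembin

end Literature.Probability.Percolation
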